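import Mathlib
import Summits.NavierStokesRegularity.NavierStokesRegularity.Theorems.EulerZoomLiouvillePowerGaugeEulerLiouvilleNeedleClockThresholdMember
import Summits.NavierStokesRegularity.NavierStokesRegularity.Theorems.EulerZoomLiouvillePowerGaugeEulerLiouvilleNeedleAxisymNoSwirlMember
import HarnessLib.Audit

/-!
# Crux E `EulerZoomLiouville.PowerGaugeEulerLiouville` — THE RESIDENCE-CLOCK KILLS FOR PAST-EXACT MEMBERS
# (ROUND-38 (T_log) ∘ (K′) and (T_pow) ∘ (K″), shifted twins): a member exactly self-similar about `(T, x₀)` on a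
# past sub-slab whose `C²` profile carries a residence clock of strength `s₁ log R`, or of strength `c′R^{2+ρ}` for
# every `c′ > 0`, is trivial

Route №10 `EulerZoomLiouville` (NavierStokesRegularity), crux E = stmt-NavierStokesRegularity-19832, line `birth`,
registered residue `stub_selfSimilarC2Needle` (THE ONE STATEMENT) and the past disjunct `IsPastSelfSimilarClassical`;
memo ROUND-38 «THE WAITING-TIME EXPONENT» of the cell `ns-regularity-ideate` (text custody nsreg-p2 g33); width seat
ns-ezl-w4 g4, LEAD key «P-CLK».  The PAST/SHIFTED twins of `NeedleRace.selfSimilar_ae_eq_zero_of_logClockC2` (p644129,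
`…NeedleWaitingTimeMember`) and `NeedleRace.selfSimilar_ae_eq_zero_of_subcriticalClockC2` (p645025,
`…NeedleClockThresholdMember`), with the binder prefix of `Past.selfSimilar_ae_eq_zero_of_vorticalFastChannelC2_profile_free_past`
(p645615): the member is exactly self-similar about `(T, x₀)` for `τ < T₁` (`T₁ ≤ 0`, `T₁ ≤ T`), with profile `(V, P)` in
its own similarity coordinates; the clock hypotheses are those of p644129 / p645025 VERBATIM (they are statements about
the profile `V` alone).

* `needleBudgets_of_selfSimilarC2_past` — the (K′)/(K″) inputs of a past-exact `C²` member: `V` is divergence free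
  (far-past extension `Shifted.isDistributional_selfSimilarCollapse_of_past` + `ProfileEquation.profile_isWeaklyDivFree`)
  and its energy / Dirichlet budgets on closed balls `L ≥ 1` grow like `cA L^{1−2ρ}` / `cE L^{1−ρ}` with REAL constants
  (far-past gauges `Shifted.profile_energy_growth_of_gaugeA_past`, `NeedleRace.lintegral_fderiv_sq_ball_le_of_past` at
  `L ≥ 2 − T₁`, patched down to `L ≥ 1` by `NeedleRace.lintegral_closedBall_le_of_ballGrowth`);
* `thinFastExits_of_selfSimilarC2_past` — past twin of `thinFastExits_of_selfSimilarC2`: divergence-freeness and the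
  general (symmetry-free) super-polynomially thin fast exits `NeedleFastSetMeasure.thinFastExits` (κ = 1);
* `waitingTime_law_of_selfSimilarC2_past` — past twin of the general-3-D waiting-time law (ROUND-38 (W));
* **`selfSimilar_ae_eq_zero_of_logClockC2_past`** — crux hypotheses verbatim (`0 < ρ ≤ ½`) + past-exact self-similarity
  about `(T, x₀)` + `V ∈ C²` + a residence clock of strength `s₁ log R` (`s₁ ≥ 0`) ⇒ `u = 0` a.e. on `(−∞,0) × ℝ³`
  (`curl_eq_zero_of_logClock_of_thinFastExits`, `Past.profile_eq_zero_of_irrotationalC2`, `Past.ae_eq_zero_of_profile_eq_zero`);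
* **`selfSimilar_ae_eq_zero_of_subcriticalClockC2_past`** — the same with a residence clock of strength `c′R^{2+ρ}` for
  EVERY `c′ > 0` (`NeedleFastSetMeasure.thinFastExits_strong'`, `curl_eq_zero_of_powerClock_of_strongThinExits`).

For the skeleton (LEAD): `… ∧ ContDiff ℝ 2 V ∧ HasResidenceClock ρ V` becomes an alternative of the past disjunct
`IsPastSelfSimilarClassical`, filled by these two theorems exactly as `stub_selfSimilarClockedExits` is filled by
p644129 / p645025 at the origin.
HONEST LABEL: conditional model-class strata (the clock is the hypothesis; in general none is known).  WHAT THIS IS NOT: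
not NS, not E — 19832 is a crux CLASS on the MODEL lattice (E/NS strata) and stays OPEN; NS regularity is NOT proved.
References: Constantin–Ignatova–Vicol arXiv:2602.17570 §3.4–§3.5 [ConstantinIgnatovaVicol2026Putative]; Maz'ya, Sobolev
Spaces §2.2.3 (capacity–area, behind t39b) [folklore].
-/

noncomputable section

-- the summit and its single problem share the name `NavierStokesRegularity` (D-0017 nested layout)
set_option linter.dupNamespace false

open Set Filter Topology Metric Function MeasureTheory InnerProductSpace
open scoped RealInnerProductSpace NNReal ENNReal

namespace Summit.NavierStokesRegularity.NavierStokesRegularity.Theorems.PowerGaugeEulerLiouville.NeedleRace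

open Literature.Analysis Literature.Analysis.FluidPDE Literature.Analysis.FunctionSpaces
open Summit.NavierStokesRegularity.NavierStokesRegularity.Theorems.PowerGaugeEulerLiouville

variable {ρ T T₁ : ℝ} {V : EuclideanSpace ℝ (Fin 3) → EuclideanSpace ℝ (Fin 3)}
  {u : ℝ → EuclideanSpace ℝ (Fin 3) → EuclideanSpace ℝ (Fin 3)} {p : ℝ → EuclideanSpace ℝ (Fin 3) → ℝ}
  {H : ℝ → EuclideanSpace ℝ (Fin 3) → EuclideanSpace ℝ (Fin 3) →L[ℝ] EuclideanSpace ℝ (Fin 3)} {c : ℝ≥0}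
  {P : EuclideanSpace ℝ (Fin 3) → ℝ}

/-! ### Profile-level inputs of a past-exact `C²` member: divergence-freeness and the closed-ball budgets -/

/-- **The (K′)/(K″) inputs of a past-exact `C²` member.**  If `u(τ, x) = (T−τ)^{γ−1} V((T−τ)^{−γ}(x − x₀))`,
`p(τ, x) = (T−τ)^{2γ−2} P(…)` for `τ < T₁` (`T₁ ≤ 0`, `T₁ ≤ T`, `γ = 1/(2+ρ)`, `0 < ρ ≤ ½`), `(u, p)` is distributional on the
slab with the `A`- and `E`-gauges of the class and `V ∈ C²`, then `V` is divergence free and, for some real `cA, cE ≥ 0`,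
`∫⁻_{B̄_L} ‖V‖² ≤ cA L^{1−2ρ}` and `∫⁻_{B̄_L} ‖DV‖² ≤ cE L^{1−ρ}` for every `L ≥ 1`. [folklore] -/
theorem needleBudgets_of_selfSimilarC2_past (hρ : 0 < ρ) (hρh : ρ ≤ 1 / 2) (hT₁ : T₁ ≤ 0) (hTT₁ : T₁ ≤ T)
    (x₀ : EuclideanSpace ℝ (Fin 3))
    (hsol : IsDistributionalNSSolutionOn (slab (EuclideanSpace ℝ (Fin 3)) (Iio 0) isOpen_Iio) 0 0 u p)
    (hH : HasWeakSpatialGradientOn (slab (EuclideanSpace ℝ (Fin 3)) (Iio 0) isOpen_Iio) u H)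
    (hA : ∀ a : ℝ, 0 < a → ENNReal.ofReal (a ^ (2 * ρ)) *
      cknA a (0 : ℝ × EuclideanSpace ℝ (Fin 3)) u ≤ (c : ℝ≥0∞))
    (hE : ∀ a : ℝ, 0 < a → ENNReal.ofReal (a ^ ρ) *
      cknE a (0 : ℝ × EuclideanSpace ℝ (Fin 3)) H ≤ (c : ℝ≥0∞))
    (hu : ∀ τ : ℝ, τ < T₁ → u τ = fun x => selfSimilarCollapse (1 / (2 + ρ)) T V τ (x - x₀))
    (hp : ∀ τ : ℝ, τ < T₁ → p τ = fun x => selfSimilarCollapsePressure (1 / (2 + ρ)) T P τ (x - x₀))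
    (hV : ContDiff ℝ 2 V) :
    VectorCalculus.IsDivFree V ∧ ∃ cA cE : ℝ, 0 ≤ cA ∧ 0 ≤ cE ∧
      (∀ L : ℝ, 1 ≤ L →
        ∫⁻ z in closedBall (0 : EuclideanSpace ℝ (Fin 3)) L, ‖V z‖ₑ ^ 2 ≤ ENNReal.ofReal (cA * L ^ (1 - 2 * ρ))) ∧
      (∀ L : ℝ, 1 ≤ L →
        ∫⁻ z in closedBall (0 : EuclideanSpace ℝ (Fin 3)) L, ‖fderiv ℝ V z‖ₑ ^ 2 ≤
          ENNReal.ofReal (cE * L ^ (1 - ρ))) := by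
  have hρ1' : ρ < 1 := by linarith
  have hL₁ : (2 : ℝ) ≤ 2 - T₁ := by linarith
  -- divergence free: the far-past extension is an exactly self-similar distributional solution on the whole slab
  have hext := Shifted.isDistributional_selfSimilarCollapse_of_past hT₁ hTT₁ x₀ hsol hu hp
  have hdivw : IsWeaklyDivFree V :=
    ProfileEquation.profile_isWeaklyDivFree hext (fun _ _ => rfl) hV.continuous.locallyIntegrable
  have hdiv : VectorCalculus.IsDivFree V := hdivw.isDivFree_of_contDiff (hV.of_le (by norm_num))
  -- the class budgets of the profile (large scales from the far past, patched down to `L ≥ 1`)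
  obtain ⟨CA, hCA, hgrA⟩ := Shifted.profile_energy_growth_of_gaugeA_past hρ hρh hT₁ hTT₁ x₀ hu hA
  obtain ⟨CE, hCE, hgrE⟩ :=
    lintegral_fderiv_sq_ball_le_of_past hρ hρ1' hT₁ hTT₁ x₀ hH hu hE (hV.of_le one_le_two)
  refine ⟨hdiv, CA.toReal * (2 - T₁) ^ (1 - 2 * ρ), CE.toReal * (2 - T₁) ^ (1 - ρ),
    mul_nonneg ENNReal.toReal_nonneg (Real.rpow_nonneg (by linarith) _),
    mul_nonneg ENNReal.toReal_nonneg (Real.rpow_nonneg (by linarith) _),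
    fun L hL => lintegral_closedBall_le_of_ballGrowth hCA hL₁ hgrA hL,
    fun L hL => lintegral_closedBall_le_of_ballGrowth hCE hL₁ hgrE hL⟩

/-- **Past twin of `thinFastExits_of_selfSimilarC2`**: the class data of a past-exact `C²` member in the shape (K′)
consumes — the profile's divergence-freeness and the general thin fast exits `NeedleFastSetMeasure.thinFastExits` on its
closed-ball budgets (`κ = 1`, `γ = 1/(2+ρ)`). [cite: ConstantinIgnatovaVicol2026Putative, §3.4.1 eq. (3.21)-(3.22)] -/
theorem thinFastExits_of_selfSimilarC2_past (hρ : 0 < ρ) (hρh : ρ ≤ 1 / 2) (hT₁ : T₁ ≤ 0) (hTT₁ : T₁ ≤ T)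
    (x₀ : EuclideanSpace ℝ (Fin 3))
    (hsol : IsDistributionalNSSolutionOn (slab (EuclideanSpace ℝ (Fin 3)) (Iio 0) isOpen_Iio) 0 0 u p)
    (hH : HasWeakSpatialGradientOn (slab (EuclideanSpace ℝ (Fin 3)) (Iio 0) isOpen_Iio) u H)
    (hA : ∀ a : ℝ, 0 < a → ENNReal.ofReal (a ^ (2 * ρ)) *
      cknA a (0 : ℝ × EuclideanSpace ℝ (Fin 3)) u ≤ (c : ℝ≥0∞))
    (hE : ∀ a : ℝ, 0 < a → ENNReal.ofReal (a ^ ρ) *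
      cknE a (0 : ℝ × EuclideanSpace ℝ (Fin 3)) H ≤ (c : ℝ≥0∞))
    (hu : ∀ τ : ℝ, τ < T₁ → u τ = fun x => selfSimilarCollapse (1 / (2 + ρ)) T V τ (x - x₀))
    (hp : ∀ τ : ℝ, τ < T₁ → p τ = fun x => selfSimilarCollapsePressure (1 / (2 + ρ)) T P τ (x - x₀))
    (hV : ContDiff ℝ 2 V) :
    VectorCalculus.IsDivFree V ∧
      ∀ m : ℝ, ∃ R₀ : ℝ, ∀ R : ℝ, R₀ ≤ R →
        ∃ (G : Set ℝ) (N : Set (EuclideanSpace ℝ (Fin 3))),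
          MeasurableSet G ∧ G ⊆ Icc (R ^ 2) ((2 * R) ^ 2) ∧ 1 * R ^ 2 ≤ (volume G).toReal ∧
          MeasurableSet N ∧ N ⊆ closedBall (0 : EuclideanSpace ℝ (Fin 3)) (2 * R) ∧
          (∀ z : EuclideanSpace ℝ (Fin 3), ‖z‖ ^ 2 ∈ G →
            ⟪V z, z⟫ + 1 / (2 + ρ) * ‖z‖ ^ 2 < 0 → z ∈ N) ∧
          volume N * ∫⁻ z in N, ENNReal.ofReal (‖V z‖ ^ 2) ≤ ENNReal.ofReal (R ^ (-m)) := by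
  have h2ρ : (0 : ℝ) < 2 + ρ := by linarith
  have hγ : (0 : ℝ) < 1 / (2 + ρ) := one_div_pos.2 h2ρ
  obtain ⟨hdiv, cA, cE, hcA, hcE, hbA, hbE⟩ :=
    needleBudgets_of_selfSimilarC2_past hρ hρh hT₁ hTT₁ x₀ hsol hH hA hE hu hp hV
  exact ⟨hdiv, NeedleFastSetMeasure.thinFastExits (hV.of_le (by norm_num)) hγ hρ.le hcA hcE hbA hbE⟩

/-! ### Member level, past-exact about `(T, x₀)` -/

/-- **THE GENERAL-3-D WAITING-TIME LAW AT MEMBER LEVEL, PAST-EXACT TWIN (ROUND-38 (W)).**  Crux hypotheses verbatim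
(`0 < ρ ≤ ½`) + exact self-similarity about `(T, x₀)` for `τ < T₁` (`T₁ ≤ 0`, `T₁ ≤ T`) with a `C²` profile `V` ⇒ for every
`m` there is `R₀ ≥ 1` such that for all `R ≥ R₀`, every cut-off copy `V'` of `V` beyond `2R`, every `S ≥ 0` and every
measurable blob `B₀ ⊆ B̄_R`, the labels of `B₀` whose backward similarity orbit leaves `‖·‖ ≤ 2R` before time `S` have
volume `≤ (4/R) · ((e^{3γS} − 1)/(3γ)) · √(R^{−m})`, `γ = 1/(2+ρ)`. [cite: ConstantinIgnatovaVicol2026Putative, §3.4.1 eq. (3.21)-(3.22), §3.5] -/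
theorem waitingTime_law_of_selfSimilarC2_past (hρ : 0 < ρ) (hρh : ρ ≤ 1 / 2) (hT₁ : T₁ ≤ 0) (hTT₁ : T₁ ≤ T)
    (x₀ : EuclideanSpace ℝ (Fin 3))
    (hsw : IsSuitableWeakSolutionOn (slab (EuclideanSpace ℝ (Fin 3)) (Iio 0) isOpen_Iio) 0 0 u p)
    (hH : HasWeakSpatialGradientOn (slab (EuclideanSpace ℝ (Fin 3)) (Iio 0) isOpen_Iio) u H)
    (hgauge : ∀ a : ℝ, 0 < a →
      ENNReal.ofReal (a ^ (2 * ρ)) * cknA a (0 : ℝ × EuclideanSpace ℝ (Fin 3)) u +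
          ENNReal.ofReal (a ^ ρ) * cknE a (0 : ℝ × EuclideanSpace ℝ (Fin 3)) H +
        ENNReal.ofReal (a ^ (2 * ρ)) * cknD a (0 : ℝ × EuclideanSpace ℝ (Fin 3)) p ≤ (c : ℝ≥0∞))
    (hu : ∀ τ : ℝ, τ < T₁ → u τ = fun x => selfSimilarCollapse (1 / (2 + ρ)) T V τ (x - x₀))
    (hp : ∀ τ : ℝ, τ < T₁ → p τ = fun x => selfSimilarCollapsePressure (1 / (2 + ρ)) T P τ (x - x₀))
    (hV : ContDiff ℝ 2 V) (m : ℝ) :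
    ∃ R₀ : ℝ, 1 ≤ R₀ ∧ ∀ R : ℝ, R₀ ≤ R →
      ∀ {V' : EuclideanSpace ℝ (Fin 3) → EuclideanSpace ℝ (Fin 3)}, ContDiff ℝ 2 V' →
      ∀ {K : ℝ}, (∀ y, ‖fderiv ℝ V' y‖ ≤ K) →
      ∀ {Rbig : ℝ}, 2 * R < Rbig → (∀ w ∈ ball (0 : EuclideanSpace ℝ (Fin 3)) Rbig, V' w = V w) →
      ∀ {S : ℝ}, 0 ≤ S →
      ∀ {B₀ : Set (EuclideanSpace ℝ (Fin 3))}, MeasurableSet B₀ →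
        B₀ ⊆ closedBall (0 : EuclideanSpace ℝ (Fin 3)) R →
        (volume (B₀ \ {y | ∀ σ ∈ Icc 0 S,
            ‖ODE.evolutionMap (fun _ : ℝ => selfSimilarTransport (1 / (2 + ρ)) 0 V') 0 (-σ) y‖ ≤ 2 * R})).toReal ≤
          4 / R * ((Real.exp (3 * (1 / (2 + ρ)) * S) - 1) / (3 * (1 / (2 + ρ)))) * Real.sqrt (R ^ (-m)) := by
  have h2ρ : (0 : ℝ) < 2 + ρ := by linarith
  have hγ : (0 : ℝ) < 1 / (2 + ρ) := one_div_pos.2 h2ρ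
  have hA : ∀ a : ℝ, 0 < a → ENNReal.ofReal (a ^ (2 * ρ)) *
      cknA a (0 : ℝ × EuclideanSpace ℝ (Fin 3)) u ≤ (c : ℝ≥0∞) :=
    fun a ha => le_trans (le_trans le_self_add le_self_add) (hgauge a ha)
  have hE : ∀ a : ℝ, 0 < a → ENNReal.ofReal (a ^ ρ) *
      cknE a (0 : ℝ × EuclideanSpace ℝ (Fin 3)) H ≤ (c : ℝ≥0∞) :=
    fun a ha => le_trans (le_trans le_add_self le_self_add) (hgauge a ha)
  obtain ⟨hdiv, hthin⟩ :=
    thinFastExits_of_selfSimilarC2_past hρ hρh hT₁ hTT₁ x₀ hsw.distributional hH hA hE hu hp hV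
  obtain ⟨R₀, hR₀1, hR₀⟩ := volume_exit_toReal_le_of_thinFastExits (γ := 1 / (2 + ρ)) hdiv hγ one_pos hthin m
  refine ⟨R₀, hR₀1, ?_⟩
  intro R hR V' hV' K hK Rbig hRbig hVU S hS B₀ hB₀m hB₀R
  have h := hR₀ R hR hV' hK hRbig hVU hS hB₀m hB₀R
  simpa only [one_mul] using h

/-- **THE LOG-CLOCK THRESHOLD AT MEMBER LEVEL, PAST-EXACT TWIN (ROUND-38 (T_log) ∘ (K′)).**  Crux hypotheses verbatim
(`0 < ρ ≤ ½`) + exact self-similarity about `(T, x₀)` for `τ < T₁` (`T₁ ≤ 0`, `T₁ ≤ T`) + a `C²` profile `V` carrying a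
RESIDENCE CLOCK of strength `s₁ log R` (`s₁ ≥ 0`; around every vortical point a ball at most half of whose labels stay in
`‖·‖ ≤ 2R` during backward similarity time `s₁ log R`, all large `R`, every cut-off copy of the profile beyond `2R` — the
hypothesis `hclock` of `selfSimilar_ae_eq_zero_of_logClockC2` verbatim) ⇒ `u = 0` a.e. on `(−∞,0) × ℝ³`.
[cite: ConstantinIgnatovaVicol2026Putative, §3.5] -/
theorem selfSimilar_ae_eq_zero_of_logClockC2_past (hρ : 0 < ρ) (hρh : ρ ≤ 1 / 2) (hT₁ : T₁ ≤ 0) (hTT₁ : T₁ ≤ T)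
    (x₀ : EuclideanSpace ℝ (Fin 3))
    (hsw : IsSuitableWeakSolutionOn (slab (EuclideanSpace ℝ (Fin 3)) (Iio 0) isOpen_Iio) 0 0 u p)
    (hH : HasWeakSpatialGradientOn (slab (EuclideanSpace ℝ (Fin 3)) (Iio 0) isOpen_Iio) u H)
    (hgauge : ∀ a : ℝ, 0 < a →
      ENNReal.ofReal (a ^ (2 * ρ)) * cknA a (0 : ℝ × EuclideanSpace ℝ (Fin 3)) u +
          ENNReal.ofReal (a ^ ρ) * cknE a (0 : ℝ × EuclideanSpace ℝ (Fin 3)) H +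
        ENNReal.ofReal (a ^ (2 * ρ)) * cknD a (0 : ℝ × EuclideanSpace ℝ (Fin 3)) p ≤ (c : ℝ≥0∞))
    (hu : ∀ τ : ℝ, τ < T₁ → u τ = fun x => selfSimilarCollapse (1 / (2 + ρ)) T V τ (x - x₀))
    (hp : ∀ τ : ℝ, τ < T₁ → p τ = fun x => selfSimilarCollapsePressure (1 / (2 + ρ)) T P τ (x - x₀))
    (hV : ContDiff ℝ 2 V) {s₁ : ℝ} (hs₁ : 0 ≤ s₁)
    (hclock : ∀ x₀ : EuclideanSpace ℝ (Fin 3), curl V x₀ ≠ 0 → ∃ r : ℝ, 0 < r ∧ ∃ R₀ : ℝ, ∀ R : ℝ, R₀ ≤ R →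
      ∀ (V' : EuclideanSpace ℝ (Fin 3) → EuclideanSpace ℝ (Fin 3)) (K Rbig : ℝ), ContDiff ℝ 2 V' →
        (∀ y, ‖fderiv ℝ V' y‖ ≤ K) → 2 * R < Rbig →
        (∀ w ∈ ball (0 : EuclideanSpace ℝ (Fin 3)) Rbig, V' w = V w) →
        (volume (ball x₀ r ∩ {y | ∀ σ ∈ Icc 0 (s₁ * Real.log R),
          ‖ODE.evolutionMap (fun _ : ℝ => selfSimilarTransport (1 / (2 + ρ)) 0 V') 0 (-σ) y‖ ≤ 2 * R})).toReal ≤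
          (volume (ball x₀ r)).toReal / 2) :
    uncurry u =ᵐ[volume.restrict (Iio (0 : ℝ) ×ˢ (univ : Set (EuclideanSpace ℝ (Fin 3))))] 0 := by
  have h2ρ : (0 : ℝ) < 2 + ρ := by linarith
  have hγ : (0 : ℝ) < 1 / (2 + ρ) := one_div_pos.2 h2ρ
  have hA : ∀ a : ℝ, 0 < a → ENNReal.ofReal (a ^ (2 * ρ)) *
      cknA a (0 : ℝ × EuclideanSpace ℝ (Fin 3)) u ≤ (c : ℝ≥0∞) :=
    fun a ha => le_trans (le_trans le_self_add le_self_add) (hgauge a ha)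
  have hE : ∀ a : ℝ, 0 < a → ENNReal.ofReal (a ^ ρ) *
      cknE a (0 : ℝ × EuclideanSpace ℝ (Fin 3)) H ≤ (c : ℝ≥0∞) :=
    fun a ha => le_trans (le_trans le_add_self le_self_add) (hgauge a ha)
  obtain ⟨hdiv, hthin⟩ :=
    thinFastExits_of_selfSimilarC2_past hρ hρh hT₁ hTT₁ x₀ hsw.distributional hH hA hE hu hp hV
  have hc0 : ∀ x, curl V x = 0 :=
    curl_eq_zero_of_logClock_of_thinFastExits (γ := 1 / (2 + ρ)) hV hdiv hγ one_pos hthin hs₁ hclock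
  exact Past.ae_eq_zero_of_profile_eq_zero hρ.le hsw hH hgauge hu
    (Past.profile_eq_zero_of_irrotationalC2 hρ hρh hT₁ hTT₁ hsw.distributional hA hu hp hV hc0)

/-- **THE WAITING-TIME EXPONENT AT MEMBER LEVEL, PAST-EXACT TWIN (ROUND-38 (T_pow) ∘ (K″)).**  Crux hypotheses verbatim
(`0 < ρ ≤ ½`) + exact self-similarity about `(T, x₀)` for `τ < T₁` (`T₁ ≤ 0`, `T₁ ≤ T`) + a `C²` velocity profile `V`
carrying, for EVERY `c′ > 0`, a residence clock of strength `c′R^{2+ρ}` (the hypothesis `hclock` of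
`selfSimilar_ae_eq_zero_of_subcriticalClockC2` verbatim) ⇒ `u = 0` a.e. on `(−∞,0) × ℝ³`.
[cite: ConstantinIgnatovaVicol2026Putative, §3.5] -/
theorem selfSimilar_ae_eq_zero_of_subcriticalClockC2_past (hρ : 0 < ρ) (hρh : ρ ≤ 1 / 2) (hT₁ : T₁ ≤ 0)
    (hTT₁ : T₁ ≤ T) (x₀ : EuclideanSpace ℝ (Fin 3))
    (hsw : IsSuitableWeakSolutionOn (slab (EuclideanSpace ℝ (Fin 3)) (Iio 0) isOpen_Iio) 0 0 u p)
    (hH : HasWeakSpatialGradientOn (slab (EuclideanSpace ℝ (Fin 3)) (Iio 0) isOpen_Iio) u H)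
    (hgauge : ∀ a : ℝ, 0 < a →
      ENNReal.ofReal (a ^ (2 * ρ)) * cknA a (0 : ℝ × EuclideanSpace ℝ (Fin 3)) u +
          ENNReal.ofReal (a ^ ρ) * cknE a (0 : ℝ × EuclideanSpace ℝ (Fin 3)) H +
        ENNReal.ofReal (a ^ (2 * ρ)) * cknD a (0 : ℝ × EuclideanSpace ℝ (Fin 3)) p ≤ (c : ℝ≥0∞))
    (hu : ∀ τ : ℝ, τ < T₁ → u τ = fun x => selfSimilarCollapse (1 / (2 + ρ)) T V τ (x - x₀))
    (hp : ∀ τ : ℝ, τ < T₁ → p τ = fun x => selfSimilarCollapsePressure (1 / (2 + ρ)) T P τ (x - x₀))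
    (hV : ContDiff ℝ 2 V)
    (hclock : ∀ c' : ℝ, 0 < c' → ∀ x₀ : EuclideanSpace ℝ (Fin 3), curl V x₀ ≠ 0 → ∃ r : ℝ, 0 < r ∧ ∃ R₀ : ℝ,
      ∀ R : ℝ, R₀ ≤ R → ∀ (V' : EuclideanSpace ℝ (Fin 3) → EuclideanSpace ℝ (Fin 3)) (K Rbig : ℝ), ContDiff ℝ 2 V' →
        (∀ y, ‖fderiv ℝ V' y‖ ≤ K) → 2 * R < Rbig →
        (∀ w ∈ ball (0 : EuclideanSpace ℝ (Fin 3)) Rbig, V' w = V w) →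
        (volume (ball x₀ r ∩ {y | ∀ σ ∈ Icc 0 (c' * R ^ (2 + ρ)),
          ‖ODE.evolutionMap (fun _ : ℝ => selfSimilarTransport (1 / (2 + ρ)) 0 V') 0 (-σ) y‖ ≤ 2 * R})).toReal ≤
          (volume (ball x₀ r)).toReal / 2) :
    uncurry u =ᵐ[volume.restrict (Iio (0 : ℝ) ×ˢ (univ : Set (EuclideanSpace ℝ (Fin 3))))] 0 := by
  have h2ρ : (0 : ℝ) < 2 + ρ := by linarith
  have hγ : (0 : ℝ) < 1 / (2 + ρ) := one_div_pos.2 h2ρ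
  have hA : ∀ a : ℝ, 0 < a → ENNReal.ofReal (a ^ (2 * ρ)) *
      cknA a (0 : ℝ × EuclideanSpace ℝ (Fin 3)) u ≤ (c : ℝ≥0∞) :=
    fun a ha => le_trans (le_trans le_self_add le_self_add) (hgauge a ha)
  have hE : ∀ a : ℝ, 0 < a → ENNReal.ofReal (a ^ ρ) *
      cknE a (0 : ℝ × EuclideanSpace ℝ (Fin 3)) H ≤ (c : ℝ≥0∞) :=
    fun a ha => le_trans (le_trans le_add_self le_self_add) (hgauge a ha)
  -- divergence-free profile and the class budgets on closed balls
  obtain ⟨hdiv, cA, cE, hcA, hcE, hbA, hbE⟩ :=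
    needleBudgets_of_selfSimilarC2_past hρ hρh hT₁ hTT₁ x₀ hsw.distributional hH hA hE hu hp hV
  -- (K″): strong thin exits
  obtain ⟨β, hβ, C, hC, hthinS⟩ :=
    NeedleFastSetMeasure.thinFastExits_strong' (hV.of_le (by norm_num)) hγ hρ.le hρh hcA hcE hbA hbE
  -- the clock at strength `c′ = β/(12γ)`, so that `6γc′ = β/2 < β`
  set c' : ℝ := β / (12 * (1 / (2 + ρ))) with hc'
  have hc'0 : 0 < c' := by rw [hc']; positivity
  have hβc : 6 * (1 / (2 + ρ)) * c' < β := by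
    rw [hc']
    field_simp
    nlinarith [hβ, h2ρ]
  have hc0 : ∀ x, curl V x = 0 :=
    curl_eq_zero_of_powerClock_of_strongThinExits (γ := 1 / (2 + ρ)) (e := 2 + ρ) hV hdiv hγ one_pos
      (by linarith) hC hthinS hc'0.le hβc (hclock c' hc'0)
  exact Past.ae_eq_zero_of_profile_eq_zero hρ.le hsw hH hgauge hu
    (Past.profile_eq_zero_of_irrotationalC2 hρ hρh hT₁ hTT₁ hsw.distributional hA hu hp hV hc0)

end Summit.NavierStokesRegularity.NavierStokesRegularity.Theorems.PowerGaugeEulerLiouville.NeedleRace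

end
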